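import Summits.CriticalPhenomena.PercolationContinuityZ3.Theorems.Transplant.SqShadowInjective
import Literature.Probability.Percolation.LatticeSymmetry
import Literature.Probability.LatticeModels.PerfectMatchingCount
import Literature.Barriers.CriticalPhenomena.AmenableInvariantPercolationZd
import Literature.Barriers.CriticalPhenomena.SubexponentialGrowthZd
import Literature.Barriers.CriticalPhenomena.SubexponentialGrowthZdBurtonKeane
import HarnessLib

/-!
# THE SQUARE LATTICE `ℤ²` AS AN (INJECTIVE) SQUARE SHADOW — Harris' theorem `θ(p_c) = 0` by Duminil-Copin–Sidoravicius–Tassion's argument, WITHOUT RSW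

builds on p205010 (kernel theorem, internal audit signed; external expert review pending) — NOT used in this file.  Lane `prim-bschramm`, seat `prim-bschramm-p2` (gen 42; class C1b;
memo `HOME/bschramm/P2-LATTICES.md` §148 (6)); helper file (`--supports stmt-CriticalPhenomena-4575 --as helper`).
The first customer of the square DST layer «SqShadow*» that discharges EVERY hypothesis: `ℤ²` with the identity shadow (`zd2SqShadow`: period `1`, the quarter turn
`transposeIso ∘ reflectIso 0`, the mirror `reflectIso 1`), connected, Burton–Keane uniqueness at every density (quasi-transitive + amenable); the shadow is injective, so the located
surgeries are vacuous («SqShadowInjective») and **`zd2_theta_criticalProb_eq_zero`**: `θ_v(p_c) = 0` on `ℤ²` — Harris' theorem (in the tree already via Harris–Kesten/RSW), here as an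
end-to-end test of the transplanted DST chain (eq. (1), Lemmata 4–7, eqs. (10)–(13), §2.2, Fact 1).  Independent of p205010.
[cite: DuminilCopinSidoraviciusTassion2016, Thm. 1 and §2 (the case k = 0 of the slab)] [cite: Harris1960, Thm.] [cite: BenjaminiSchramm1996, Conj. 4 / Question 3]
-/

noncomputable section

namespace Summit.CriticalPhenomena.PercolationContinuityZ3.Theorems.Transplant

open MeasureTheory Literature.Probability.Percolation Literature.Probability.LatticeModels SimpleGraph Filter
open Literature.Barriers.CriticalPhenomena (zdGraph_connected zdGraph_isQuasiTransitive isGraphAmenable_zdGraph BurtonKeane1989_atMostOneInfiniteCluster_holds)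
open scoped Classical Topology

/-- **`ℤ²` as a square shadow of itself** (identity shadow, period `1`, centre `0`). [cite: DuminilCopinSidoraviciusTassion2016, §2 (k = 0)] -/
def zd2SqShadow : SqShadow (zdGraph 2) where
  sh := id
  lip := fun _ _ h => Or.inr h
  fibre := fun z => (Set.finite_singleton z).subset fun v hv => hv
  period := 1
  period_pos := Nat.one_pos
  centre := 0
  shift := fun t => ⟨zdGraphShiftIso t, fun w => by simp⟩
  rot := ⟨transposeIso.trans (reflectIso 0), fun w => by
    ext i; fin_cases i
    · show reflectIso 0 (transposeIso w) 0 - (0 : Site 2) 0 = sqRot90 (w - 0) 0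
      rw [reflectIso_apply_same, transposeIso_apply_zero, sub_zero, sqRot90_apply_zero]; simp
    · show reflectIso 0 (transposeIso w) 1 - (0 : Site 2) 1 = sqRot90 (w - 0) 1
      rw [reflectIso_apply_of_ne (by decide), transposeIso_apply_one, sub_zero, sqRot90_apply_one]; simp⟩
  refl := ⟨reflectIso 1, fun w => by
    ext i; fin_cases i
    · show reflectIso 1 w 0 - (0 : Site 2) 0 = sqFlip (w - 0) 0
      rw [reflectIso_apply_of_ne (by decide), sub_zero, sqFlip_apply_zero]; simp
    · show reflectIso 1 w 1 - (0 : Site 2) 1 = sqFlip (w - 0) 1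
      rw [reflectIso_apply_same, sub_zero, sqFlip_apply_one]; simp⟩

/-- The shadow of `zd2SqShadow` is the identity. [folklore] -/
theorem zd2SqShadow_sh (v : Site 2) : zd2SqShadow.sh v = v := rfl

/-- **HARRIS' THEOREM BY THE DST TRANSPLANT**: on `ℤ²`, `θ_v(p_c) = 0` at every vertex — from the square DST layer with the injective identity shadow, connectedness of `ℤ²` and
Burton–Keane uniqueness; no Russo–Seymour–Welsh input.  Independent of p205010. [cite: DuminilCopinSidoraviciusTassion2016, Thm. 1 (k = 0)] [cite: Harris1960, Thm.] -/
theorem zd2_theta_criticalProb_eq_zero (v : Site 2) : theta (zdGraph 2) v (criticalProbIOf (zdGraph 2) v) = 0 :=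
  zd2SqShadow.theta_criticalProb_eq_zero_of_injective (zdGraph_connected 2)
    (fun p => BurtonKeane1989_atMostOneInfiniteCluster_holds _ (zdGraph_connected 2) (zdGraph_isQuasiTransitive 2) (isGraphAmenable_zdGraph 2) p)
    (fun _ _ h => h) v

end Summit.CriticalPhenomena.PercolationContinuityZ3.Theorems.Transplant

end
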